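/-
Copyright: the b2b-balaban T⁴-continuum CRUX team, row NE7b OWNER lineage `t4-ne7b-p1` (gen 121). Project licence.
-/
import Summits.QuantumFields.BalabanUV.T4Continuum.Spine.NE7b.SupTorusNextScaleLocality
import Summits.QuantumFields.BalabanUV.T4Continuum.Spine.NE7b.SupTorusComparisonDecay

/-!
# THE ROAD'S OWN RESPONSE OPERATOR `Dt` ((100) `torus_exists_response`) IS EXPONENTIALLY LOCAL — BY NAME: block-RMS
# `(n+1)^{−d}Σ_{B_y}(Dt e_{y₀})² ≤ C·e^{−2δρ_s(y,y₀)}` on the two-sided class `−λ ≤ u′(φ ·) ≤ Λ`, and POINTWISE `|(Dt e_{y₀})(x)| ≤ C·e^{−δρ_s(bt x, y₀)}`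
# on the strictly convex class `v₀ ≤ u′(φ ·) ≤ Λ`, constants from `(d, a, λ∕v₀, Λ)` only, every mesh, every volume — because `Dt k` IS the
# superposition `Σ_{y″}(Mt k)(y″)ψ_{y″}` of the block columns with `Mt = T⁻¹` ((136)'s remarks, exported as a theorem), so (137)∕(146) apply
# (row NE7b, node U5c; (100)∕(102)∕(133)–(137)∕(146) BY NAME; [folklore])

Cell `pub-balaban`, sub-cell `t4`, spine estimate NE7b (`T4WeightBudget.RelWeightBound`; the cell's OWN estimate — NOT PRINTED in
[Bałaban 1983–89], NOT PROVED).  Crux-route work under `Spine/NE7b/` by the row OWNER (`t4-ne7b-p1` gen 121, file (150)) under FREEZE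
(0)'s crux-prover clause; NOTHING of Bałaban's is named as a Lean object, valued or asserted; no `T4Continuum/Support` leaf typed; no `def`,
no notation (every operator enters through its DISPLAYED action exactly as in (100)∕(102)∕(136)); zero `sorry`.  Imports (BY NAME): the
OWNER's (136) `…SupTorusNextScaleLocality` (its junction argument, here exported: (133) `action_injective`, `action_sum_smul`, (93)
`blockLift_of_critical`, (100) `exists_clm_diag`, (89) TDFC `torus_operator_apply`, `torus_blockAvg_apply`, Mathlib's
`LinearMap.injective_iff_surjective`, `Matrix.inv_eq_right_inv`), (146) `…SupTorusComparisonDecay` (`response_pointwise_decay`; through it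
(137) `response_local`).

WHY (located).  (137) and (146) localise `h_{y₀} = Σ_{y′}T⁻¹(y′,y₀)ψ_{y′}` for block columns `ψ` GIVEN AS DATA; the road's response is the
operator `Dt` of (100) with `Q′t∘Dt = 1` and the fibre-killing display.  (136) proved inside its headline that `H = At + u′(φ)·` is onto
(columns exist), that `Σ_{y″}(Mt k)(y″)ψ_{y″}` and `Dt k` have the same `H`-image (the block lift `(Mt k)∘bt`, (93)) hence coincide, and
that `T·Mt = 1`; §1 exports exactly this as `response_eq_superposition`, and §2 reads (137)∕(146) through it.

WHAT IS PROVED ([folklore]; the quantifier prefix of (136) `nextScale_operator_local` verbatim: operators `Dop, Aop, Ef, Rf, Rc` with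
the road's displays, `u′, φ`, `Dt` with `Q′t(Dt k) = k` and the fibre-killing display, `Mt` with (102)'s display):
* §1 **`response_eq_superposition`** (`a > 0`, `λ < min(2,a)`, `u′(φ ·) ≥ −λ`: `∃ ψ` block columns of `H` with `Dt k = Σ_{y″}(Mt k)(y″)ψ_{y″}`
  for all `k` and `(Mt e_{y′}) y = T⁻¹(y,y′)`).
* §2 **`response_operator_local`** (`−λ ≤ u′(φ ·) ≤ Λ`: `∃ C δ > 0` from `(d, a, λ, Λ)`: `(n+1)^{−d}Σ_z (Dt e_{y₀})(σ(chart (wm y) z))² ≤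
  Ce^{−2δρ_s(y,y₀)}` every `y₀, y`), **`response_operator_pointwise`** (`v₀ ≤ u′(φ ·) ≤ Λ`, `v₀ > 0`: `∃ C δ > 0` from `(d, a, v₀, Λ)`:
  `|(Dt e_{y₀})(x)| ≤ Ce^{−δρ_s(bt x, y₀)}` every `y₀`, EVERY site `x`).
* §3 toy.

HONEST (what this is NOT).  By-name junction only (no new analysis); the pointwise half on the strictly convex class only; the covariance
operator of the road ((100) `C = A⁻¹∘inr`-type displays) is not junctioned here ((139)∕(147) hold for its written-out form); constants far
from sharp; cubic periods; scalar skeleton ((A3), NC-NE7b-α UNRULED); nothing of Bałaban's.  BY-NAME EFFECT ON THE WALL: NONE.  NE7b NOT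
PRINTED ∕ NOT PROVED; spine PROVED 0∕9; rung (B)+1 on a FINITE torus — NOT infinite volume, NOT the mass gap, NOT Clay.  HONEST DEPENDENCY:
continuum YM on T⁴ ⇐ BetaPertH ∧ nine spine estimates (0∕9 proved); BetaPertH ⇐ (D1) ∧ (D4) ∧ CAP+tail; G-an2-4 gates asym, D1 and NE2∕3∕4.
-/

set_option autoImplicit false

noncomputable section

namespace Summit.QuantumFields.BalabanUV.T4Continuum.NE7b.SupTorusResponseOperatorLocality

open Real
open scoped ENNReal
open Literature.MathematicalPhysics.QuantumFieldTheory.Balaban1983to89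
open B6QGQLower276 (X e blk B side AX chart mem_B sum_B sum_B_const card_cube blk_chart)
open B5Hk103ScalarZd (nbhd)
open Beta (Site siteOf windowMap siteOf_windowMap siteOf_add)
open SupTorusDirichletFormCoercive (torus_operator_apply torus_blockAvg_apply)
open SupTorusActionMinimiser (blockLift_of_critical)
open SupTorusFibreResponse (exists_clm_diag)
open SupTorusActionForm (action_injective action_sum_smul)
open SupTorusResponseLocality (response_local)
open SupTorusComparisonDecay (response_pointwise_decay)

variable {d : ℕ}

/-! ## §1. The road's response `Dt k` IS the superposition `Σ_{y″}(Mt k)(y″)·ψ_{y″}` of block columns, and `Mt = T⁻¹` entrywise -/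

/-- **THE ROAD'S RESPONSE IS THE SUPERPOSITION OF THE BLOCK COLUMNS WEIGHTED BY `T⁻¹`** ((136)'s two remarks, exported): for `a > 0`,
`λ < min(2,a)`, ANY operators with the road's displayed actions, ANY `u′, φ` with `u′(φ ·) ≥ −λ`, ANY response `Dt` (`Q′t∘Dt = 1`, the
fibre-killing display) and `Mt` with (102)'s display, THERE ARE block columns `ψ_{y′}` of `H = At + u′(φ)·` (`Hψ_{y′} = 𝟙[bt · = y′]`) with
`Dt k = Σ_{y″}(Mt k)(y″)·ψ_{y″}` for every `k` and `(Mt e_{y′}) y = T⁻¹(y,y′)`, `T` the Schur complement of (134) on these columns. [folklore] -/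
theorem response_eq_superposition (a : ℝ) (ha : 0 < a) {lam : ℝ} (hm0 : 0 < min 2 a - lam) (n s : ℕ) [NeZero s] :
      ∀ (Dop Aop : lp (fun _ : X d => ℝ) ∞ →L[ℝ] lp (fun _ : X d => ℝ) ∞),
      (∀ (f : lp (fun _ : X d => ℝ) ∞) (y : X d), Dop f y = (((n : ℝ) + 1) ^ d)⁻¹ * ∑ p ∈ B n y, f p) →
      (∀ (f : lp (fun _ : X d => ℝ) ∞) (p : X d), Aop f p = ∑ r ∈ nbhd n p, AX n a p r * f r) →
      ∀ (Ef : (Site d ((n + 1) * s) → ℝ) →L[ℝ] lp (fun _ : X d => ℝ) ∞),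
      (∀ (g : Site d ((n + 1) * s) → ℝ) (q : X d), Ef g q = g (siteOf d ((n + 1) * s) q)) →
      ∀ (Rf : lp (fun _ : X d => ℝ) ∞ →L[ℝ] (Site d ((n + 1) * s) → ℝ)),
      (∀ (h : lp (fun _ : X d => ℝ) ∞) (x : Site d ((n + 1) * s)), Rf h x = h (windowMap d ((n + 1) * s) x)) →
      ∀ (Rc : lp (fun _ : X d => ℝ) ∞ →L[ℝ] (Site d s → ℝ)),
      (∀ (h : lp (fun _ : X d => ℝ) ∞) (x : Site d s), Rc h x = h (windowMap d s x)) →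
      ∀ (u' : ℝ → ℝ) (φ : Site d ((n + 1) * s) → ℝ), (∀ x, -lam ≤ u' (φ x)) →
      ∀ (Dt : (Site d s → ℝ) →L[ℝ] (Site d ((n + 1) * s) → ℝ)),
      (∀ k : Site d s → ℝ, ((Rc.comp Dop).comp Ef) (Dt k) = k) →
      (∀ (k : Site d s → ℝ) (κ' : Site d ((n + 1) * s) → ℝ), ((Rc.comp Dop).comp Ef) κ' = 0 →
        ∑ x, (((Rf.comp Aop).comp Ef) (Dt k) x + u' (φ x) * Dt k x) * κ' x = 0) →
      ∀ (Mt : (Site d s → ℝ) →L[ℝ] (Site d s → ℝ)),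
      (∀ (k : Site d s → ℝ) (y : Site d s),
        Mt k y = ((Rc.comp Dop).comp Ef) (fun x => ((Rf.comp Aop).comp Ef) (Dt k) x + u' (φ x) * Dt k x) y) →
      ∃ ψ : Site d s → Site d ((n + 1) * s) → ℝ,
        (∀ y' x, ((n : ℝ) + 1) ^ 2 * ∑ μ, (2 * ψ y' x - ψ y' (x + siteOf d ((n + 1) * s) (e μ)) - ψ y' (x - siteOf d ((n + 1) * s) (e μ)))
          + a / ((n : ℝ) + 1) ^ d * ∑ q ∈ B n (blk n (windowMap d ((n + 1) * s) x)), ψ y' (siteOf d ((n + 1) * s) q) + u' (φ x) * ψ y' x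
          = if siteOf d s (blk n (windowMap d ((n + 1) * s) x)) = y' then 1 else 0) ∧
        (∀ k : Site d s → ℝ, (fun x => ∑ y'', Mt k y'' * ψ y'' x) = Dt k) ∧
        (∀ y y' : Site d s, Mt (fun y'' => if y'' = y' then 1 else 0) y
          = (Matrix.of fun yy y'' : Site d s =>
              (((n : ℝ) + 1) ^ d)⁻¹ * ∑ z : Fin d → Fin (n + 1), ψ y'' (siteOf d ((n + 1) * s) (chart n (windowMap d s yy) z)))⁻¹ y y') := by
  classical
  intro Dop Aop hD hA Ef hEf Rf hRf Rc hRc u' φ hu Dt hDQ hDlin Mt hMt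
  -- the displayed forms of `At` and `Q′t`
  have hAt : ∀ (h : Site d ((n + 1) * s) → ℝ) (x : Site d ((n + 1) * s)), ((Rf.comp Aop).comp Ef) h x
      = ((n : ℝ) + 1) ^ 2 * ∑ μ, (2 * h x - h (x + siteOf d ((n + 1) * s) (e μ)) - h (x - siteOf d ((n + 1) * s) (e μ)))
        + a / ((n : ℝ) + 1) ^ d * ∑ q ∈ B n (blk n (windowMap d ((n + 1) * s) x)), h (siteOf d ((n + 1) * s) q) := fun h x => by
    simp only [ContinuousLinearMap.comp_apply]; exact torus_operator_apply n a s hA hEf hRf h x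
  have hQt : ∀ (h : Site d ((n + 1) * s) → ℝ) (y : Site d s), ((Rc.comp Dop).comp Ef) h y
      = (((n : ℝ) + 1) ^ d)⁻¹ * ∑ z : Fin d → Fin (n + 1), h (siteOf d ((n + 1) * s) (chart n (windowMap d s y) z)) := fun h y => by
    simp only [ContinuousLinearMap.comp_apply]; exact torus_blockAvg_apply n s hD hEf hRc h y
  -- `H = At + u′(φ)·` as one operator; injective, hence onto
  obtain ⟨N, hN⟩ := exists_clm_diag (ι := Site d ((n + 1) * s)) (fun x => u' (φ x))
  set Hop : (Site d ((n + 1) * s) → ℝ) →L[ℝ] (Site d ((n + 1) * s) → ℝ) := (Rf.comp Aop).comp Ef + N with hHop_def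
  have hHop : ∀ (h : Site d ((n + 1) * s) → ℝ) (x : Site d ((n + 1) * s)), Hop h x
      = ((n : ℝ) + 1) ^ 2 * ∑ μ, (2 * h x - h (x + siteOf d ((n + 1) * s) (e μ)) - h (x - siteOf d ((n + 1) * s) (e μ)))
        + a / ((n : ℝ) + 1) ^ d * ∑ q ∈ B n (blk n (windowMap d ((n + 1) * s) x)), h (siteOf d ((n + 1) * s) q)
        + u' (φ x) * h x := fun h x => by
    rw [hHop_def, _root_.add_apply, Pi.add_apply, hAt, hN]
  have hinj : Function.Injective Hop := fun u v huv =>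
    action_injective n a s ha.le hm0 (fun x => u' (φ x)) hu u v fun x => by rw [← hHop, ← hHop, huv]
  have hsurj : Function.Surjective Hop := by
    have h := (LinearMap.injective_iff_surjective (f := (Hop : (Site d ((n + 1) * s) → ℝ) →ₗ[ℝ] (Site d ((n + 1) * s) → ℝ)))).1
      (fun u v huv => hinj huv)
    exact fun f => h f
  -- the block columns `ψ_{y′}` of `H⁻¹`
  choose ψ hψ using fun y'' : Site d s =>
    hsurj fun x => if siteOf d s (blk n (windowMap d ((n + 1) * s) x)) = y'' then (1 : ℝ) else 0
  have hψ' : ∀ (y'' : Site d s) (x : Site d ((n + 1) * s)),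
      ((n : ℝ) + 1) ^ 2 * ∑ μ, (2 * ψ y'' x - ψ y'' (x + siteOf d ((n + 1) * s) (e μ)) - ψ y'' (x - siteOf d ((n + 1) * s) (e μ)))
        + a / ((n : ℝ) + 1) ^ d * ∑ q ∈ B n (blk n (windowMap d ((n + 1) * s) x)), ψ y'' (siteOf d ((n + 1) * s) q)
        + u' (φ x) * ψ y'' x
      = if siteOf d s (blk n (windowMap d ((n + 1) * s) x)) = y'' then 1 else 0 := fun y'' x => by
    rw [← hHop]; exact congrFun (hψ y'') x
  -- `T·Mt = 1`: the superposition `Σ_{y″} (Mt k)(y″)·ψ_{y″}` and `Dt k` have the same image under `H`, hence coincide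
  have hlift : ∀ (k : Site d s → ℝ) (x : Site d ((n + 1) * s)),
      ((Rf.comp Aop).comp Ef) (Dt k) x + u' (φ x) * Dt k x = Mt k (siteOf d s (blk n (windowMap d ((n + 1) * s) x))) := by
    intro k x
    rw [hMt, ← blockLift_of_critical n s hD hEf hRc (fun x => ((Rf.comp Aop).comp Ef) (Dt k) x + u' (φ x) * Dt k x) (hDlin k) x]
  have hsuper : ∀ k : Site d s → ℝ, (fun x => ∑ y'', Mt k y'' * ψ y'' x) = Dt k := by
    intro k
    refine action_injective n a s ha.le hm0 (fun x => u' (φ x)) hu _ _ fun x => ?_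
    rw [action_sum_smul n a s Finset.univ (Mt k) ψ (fun x => u' (φ x)) x]
    simp only [hψ', mul_ite, mul_one, mul_zero]
    rw [Finset.sum_ite_eq, if_pos (Finset.mem_univ _), ← hlift k x, hAt]
  have hTM : ∀ (k : Site d s → ℝ) (yy : Site d s),
      ∑ y'', ((((n : ℝ) + 1) ^ d)⁻¹ * ∑ z : Fin d → Fin (n + 1), ψ y'' (siteOf d ((n + 1) * s) (chart n (windowMap d s yy) z))) * Mt k y''
        = k yy := by
    intro k yy
    have h1 := congrFun (hDQ k) yy
    rw [hQt, ← hsuper k] at h1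
    rw [← h1, Finset.mul_sum]
    simp only [Finset.mul_sum, Finset.sum_mul]
    rw [Finset.sum_comm]
    exact Finset.sum_congr rfl fun z _ => Finset.sum_congr rfl fun y'' _ => by ring
  -- hence the matrix of `Mt` is `T⁻¹`
  set T : Matrix (Site d s) (Site d s) ℝ := Matrix.of fun yy y'' : Site d s =>
    (((n : ℝ) + 1) ^ d)⁻¹ * ∑ z : Fin d → Fin (n + 1), ψ y'' (siteOf d ((n + 1) * s) (chart n (windowMap d s yy) z)) with hT_def
  set M : Matrix (Site d s) (Site d s) ℝ := Matrix.of fun yy y'' : Site d s => Mt (fun t => if t = y'' then 1 else 0) yy with hM_def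
  have hTM1 : T * M = 1 := by
    ext yy y''
    rw [Matrix.mul_apply]
    simp only [hT_def, hM_def, Matrix.of_apply]
    rw [hTM (fun t => if t = y'' then 1 else 0) yy, Matrix.one_apply]
  have hinv : T⁻¹ = M := Matrix.inv_eq_right_inv hTM1
  exact ⟨ψ, hψ', hsuper, fun y y' => by rw [hinv]; simp only [hM_def, Matrix.of_apply]⟩

/-! ## §2. THE END: the road's response operator is exponentially local — block-RMS on the two-sided class, POINTWISE on the strictly
convex class -/

/-- **HEADLINE (two-sided class) — THE ROAD'S RESPONSE `Dt e_{y₀}` IS EXPONENTIALLY LOCAL IN BLOCK MEAN SQUARE, BY NAME**: for `a > 0`,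
`λ < min(2,a)`, `Λ ≥ 0` there are `C, δ > 0` from `(d, a, λ, Λ)` only such that for ALL `n, s`, ALL operators with the road's displays, ALL
`u′, φ` with `−λ ≤ u′(φ ·) ≤ Λ`, ALL `Dt`, `Mt` with (100)∕(102)'s displays, every `y₀` and every block `y`:
`(n+1)^{−d}Σ_z (Dt e_{y₀})(σ(chart (wm y) z))² ≤ C·e^{−2δρ_s(y,y₀)}` — (137) `response_local` through §1. [folklore] -/
theorem response_operator_local (a : ℝ) (ha : 0 < a) {lam Lam : ℝ} (hm0 : 0 < min 2 a - lam) (hLam : 0 ≤ Lam) :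
    ∃ C δ : ℝ, 0 < C ∧ 0 < δ ∧ ∀ (n s : ℕ) [NeZero s]
      (Dop Aop : lp (fun _ : X d => ℝ) ∞ →L[ℝ] lp (fun _ : X d => ℝ) ∞),
      (∀ (f : lp (fun _ : X d => ℝ) ∞) (y : X d), Dop f y = (((n : ℝ) + 1) ^ d)⁻¹ * ∑ p ∈ B n y, f p) →
      (∀ (f : lp (fun _ : X d => ℝ) ∞) (p : X d), Aop f p = ∑ r ∈ nbhd n p, AX n a p r * f r) →
      ∀ (Ef : (Site d ((n + 1) * s) → ℝ) →L[ℝ] lp (fun _ : X d => ℝ) ∞),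
      (∀ (g : Site d ((n + 1) * s) → ℝ) (q : X d), Ef g q = g (siteOf d ((n + 1) * s) q)) →
      ∀ (Rf : lp (fun _ : X d => ℝ) ∞ →L[ℝ] (Site d ((n + 1) * s) → ℝ)),
      (∀ (h : lp (fun _ : X d => ℝ) ∞) (x : Site d ((n + 1) * s)), Rf h x = h (windowMap d ((n + 1) * s) x)) →
      ∀ (Rc : lp (fun _ : X d => ℝ) ∞ →L[ℝ] (Site d s → ℝ)),
      (∀ (h : lp (fun _ : X d => ℝ) ∞) (x : Site d s), Rc h x = h (windowMap d s x)) →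
      ∀ (u' : ℝ → ℝ) (φ : Site d ((n + 1) * s) → ℝ), (∀ x, -lam ≤ u' (φ x)) → (∀ x, u' (φ x) ≤ Lam) →
      ∀ (Dt : (Site d s → ℝ) →L[ℝ] (Site d ((n + 1) * s) → ℝ)),
      (∀ k : Site d s → ℝ, ((Rc.comp Dop).comp Ef) (Dt k) = k) →
      (∀ (k : Site d s → ℝ) (κ' : Site d ((n + 1) * s) → ℝ), ((Rc.comp Dop).comp Ef) κ' = 0 →
        ∑ x, (((Rf.comp Aop).comp Ef) (Dt k) x + u' (φ x) * Dt k x) * κ' x = 0) →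
      ∀ (Mt : (Site d s → ℝ) →L[ℝ] (Site d s → ℝ)),
      (∀ (k : Site d s → ℝ) (y : Site d s),
        Mt k y = ((Rc.comp Dop).comp Ef) (fun x => ((Rf.comp Aop).comp Ef) (Dt k) x + u' (φ x) * Dt k x) y) →
      ∀ y₀ y : Site d s, (((n : ℝ) + 1) ^ d)⁻¹ * ∑ z : Fin d → Fin (n + 1),
          (Dt (fun y'' => if y'' = y₀ then 1 else 0)) (siteOf d ((n + 1) * s) (chart n (windowMap d s y) z)) ^ 2
        ≤ C * exp (-(2 * δ * ∑ i, (((y i - y₀ i).valMinAbs.natAbs : ℕ) : ℝ))) := by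
  classical
  obtain ⟨C, δ, hC, hδ, H137⟩ := response_local (d := d) a ha hm0 hLam
  refine ⟨C, δ, hC, hδ, ?_⟩
  intro n s _ Dop Aop hD hA Ef hEf Rf hRf Rc hRc u' φ hu hu' Dt hDQ hDlin Mt hMt y₀ y
  obtain ⟨ψ, hψ, hsuper, hent⟩ := response_eq_superposition (d := d) a ha hm0 n s Dop Aop hD hA Ef hEf Rf hRf Rc hRc u' φ hu Dt hDQ hDlin Mt hMt
  obtain ⟨-, -, h3⟩ := H137 n s (fun x => u' (φ x)) hu hu' ψ hψ y₀
  have hDt : ∀ x, Dt (fun y'' => if y'' = y₀ then 1 else 0) x = ∑ y', (Matrix.of fun yy y'' : Site d s =>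
      (((n : ℝ) + 1) ^ d)⁻¹ * ∑ z : Fin d → Fin (n + 1), ψ y'' (siteOf d ((n + 1) * s) (chart n (windowMap d s yy) z)))⁻¹ y' y₀ * ψ y' x := by
    intro x
    rw [← hsuper (fun y'' => if y'' = y₀ then 1 else 0)]
    exact Finset.sum_congr rfl fun y' _ => by rw [hent y' y₀]
  simp only [hDt]
  exact h3 y

/-- **HEADLINE (strictly convex class) — THE ROAD'S RESPONSE `Dt e_{y₀}` DECAYS POINTWISE, BY NAME**: for `a > 0`, `v₀ > 0`, `Λ ≥ 0` there
are `C, δ > 0` from `(d, a, v₀, Λ)` only such that for ALL `n, s`, ALL operators with the road's displays, ALL `u′, φ` with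
`v₀ ≤ u′(φ ·) ≤ Λ` (strictly convex single-site potential), ALL `Dt`, `Mt` with (100)∕(102)'s displays, every `y₀` and EVERY fine site `x`:
`|(Dt e_{y₀})(x)| ≤ C·e^{−δρ_s(bt x, y₀)}` — (146) `response_pointwise_decay` through §1. [folklore] -/
theorem response_operator_pointwise (a : ℝ) (ha : 0 < a) {v₀ Lam : ℝ} (hv₀ : 0 < v₀) (hLam : 0 ≤ Lam) :
    ∃ C δ : ℝ, 0 < C ∧ 0 < δ ∧ ∀ (n s : ℕ) [NeZero s]
      (Dop Aop : lp (fun _ : X d => ℝ) ∞ →L[ℝ] lp (fun _ : X d => ℝ) ∞),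
      (∀ (f : lp (fun _ : X d => ℝ) ∞) (y : X d), Dop f y = (((n : ℝ) + 1) ^ d)⁻¹ * ∑ p ∈ B n y, f p) →
      (∀ (f : lp (fun _ : X d => ℝ) ∞) (p : X d), Aop f p = ∑ r ∈ nbhd n p, AX n a p r * f r) →
      ∀ (Ef : (Site d ((n + 1) * s) → ℝ) →L[ℝ] lp (fun _ : X d => ℝ) ∞),
      (∀ (g : Site d ((n + 1) * s) → ℝ) (q : X d), Ef g q = g (siteOf d ((n + 1) * s) q)) →
      ∀ (Rf : lp (fun _ : X d => ℝ) ∞ →L[ℝ] (Site d ((n + 1) * s) → ℝ)),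
      (∀ (h : lp (fun _ : X d => ℝ) ∞) (x : Site d ((n + 1) * s)), Rf h x = h (windowMap d ((n + 1) * s) x)) →
      ∀ (Rc : lp (fun _ : X d => ℝ) ∞ →L[ℝ] (Site d s → ℝ)),
      (∀ (h : lp (fun _ : X d => ℝ) ∞) (x : Site d s), Rc h x = h (windowMap d s x)) →
      ∀ (u' : ℝ → ℝ) (φ : Site d ((n + 1) * s) → ℝ), (∀ x, v₀ ≤ u' (φ x)) → (∀ x, u' (φ x) ≤ Lam) →
      ∀ (Dt : (Site d s → ℝ) →L[ℝ] (Site d ((n + 1) * s) → ℝ)),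
      (∀ k : Site d s → ℝ, ((Rc.comp Dop).comp Ef) (Dt k) = k) →
      (∀ (k : Site d s → ℝ) (κ' : Site d ((n + 1) * s) → ℝ), ((Rc.comp Dop).comp Ef) κ' = 0 →
        ∑ x, (((Rf.comp Aop).comp Ef) (Dt k) x + u' (φ x) * Dt k x) * κ' x = 0) →
      ∀ (Mt : (Site d s → ℝ) →L[ℝ] (Site d s → ℝ)),
      (∀ (k : Site d s → ℝ) (y : Site d s),
        Mt k y = ((Rc.comp Dop).comp Ef) (fun x => ((Rf.comp Aop).comp Ef) (Dt k) x + u' (φ x) * Dt k x) y) →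
      ∀ (y₀ : Site d s) (x : Site d ((n + 1) * s)), |Dt (fun y'' => if y'' = y₀ then 1 else 0) x|
        ≤ C * exp (-(δ * ∑ i, ((((siteOf d s (blk n (windowMap d ((n + 1) * s) x))) i - y₀ i).valMinAbs.natAbs : ℕ) : ℝ))) := by
  classical
  have hm0 : 0 < min 2 a - (-v₀) := by have : 0 ≤ min 2 a := le_min zero_le_two ha.le; linarith
  obtain ⟨C, δ, hC, hδ, H146⟩ := response_pointwise_decay (d := d) a ha hv₀ hLam
  refine ⟨C, δ, hC, hδ, ?_⟩
  intro n s _ Dop Aop hD hA Ef hEf Rf hRf Rc hRc u' φ hu hu' Dt hDQ hDlin Mt hMt y₀ x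
  have hul : ∀ x, -(-v₀) ≤ u' (φ x) := fun x => by linarith [hu x]
  obtain ⟨ψ, hψ, hsuper, hent⟩ := response_eq_superposition (d := d) a ha hm0 n s Dop Aop hD hA Ef hEf Rf hRf Rc hRc u' φ hul Dt hDQ hDlin Mt hMt
  have hDt : Dt (fun y'' => if y'' = y₀ then 1 else 0) x = ∑ y', (Matrix.of fun yy y'' : Site d s =>
      (((n : ℝ) + 1) ^ d)⁻¹ * ∑ z : Fin d → Fin (n + 1), ψ y'' (siteOf d ((n + 1) * s) (chart n (windowMap d s yy) z)))⁻¹ y' y₀ * ψ y' x := by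
    rw [← hsuper (fun y'' => if y'' = y₀ then 1 else 0)]
    exact Finset.sum_congr rfl fun y' _ => by rw [hent y' y₀]
  rw [hDt]
  exact H146 n s (fun x => u' (φ x)) hu hu' ψ hψ y₀ x

/-! ## §3. Toy -/

/-- Toy: the constants of the pointwise headline exist for `d = 4`, `a = 1`, `v₀ = 1∕2`, `Λ = 3`. -/
example : ∃ C δ : ℝ, 0 < C ∧ 0 < δ :=
  let ⟨C, δ, hC, hδ, _⟩ := response_operator_pointwise (d := 4) 1 one_pos (v₀ := 1 / 2) (Lam := 3) (by norm_num) (by norm_num); ⟨C, δ, hC, hδ⟩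

end Summit.QuantumFields.BalabanUV.T4Continuum.NE7b.SupTorusResponseOperatorLocality
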